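import Summits.BirchSwinnertonDyer.BirchSwinnertonDyer.Theorems.ByReductionTypeAtTwoMultUpperHalfTowerLocal
import Summits.BirchSwinnertonDyer.BirchSwinnertonDyer.Theorems.ByReductionTypeAtTwoTowerLayerTorsion
import Summits.BirchSwinnertonDyer.BirchSwinnertonDyer.Theorems.ByReductionTypeAtTwoTowerClassKitD
import HarnessLib

/-!
# Route `ByReductionTypeAtTwo`, crux `MultUpperHalfAtTwo` (item stmt-BirchSwinnertonDyer-19922): the TOWER road WITH
# RATIONAL `2`-TORSION in tower-1's LOCAL-KERNEL certificate currency — the door for the 142 «neither» classes of the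
# residual of the line `four_roads` (reducible `E[2]` at every member; optimal curve neither ramified nor odd)

HONEST FRAMING (cell `bsd-2adic`, run/shared/lean/pub/bsd-2adic/, seat `bsd-2adic-mult-2` GEN 5, HUMAN RULING D-0074 row (A)):
research route; THEOREMS ONLY (no definition, no new named fact); nothing is booked; BSD is not proved by any of this.
PARTITION: X5@2 mult (K4ᵐ, RESIDUAL-MAP B1·O1; 1 976 book230 classes) × p = 2 — types-the-object-of (the per-class
certificate format of the TOWER road on the 142 «neither» rank-`0` classes of the WALL `stub_offSixRoads`: every member has
a rational `2`-torsion point, so GEN 3/4's doors — all through `¬ 2 ∣ #E(ℚ)_tors` — do not apply); closes none.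
bears_on: K4 (route-BirchSwinnertonDyer-ByReductionTypeAtTwo item 19922).

WHY THIS FILE (GEN 3 WANTED W5, GEN 4 WANTED W5). The tower road certifies the `μ = 0` input of road (i) at ONE member from
two finite layers of the cyclotomic `ℤ₂`-tower. tower-1's local-kernel doors (`KatoHalfPinch.towerGapAtTwo_of_localKernelBounds`
and everything above it: parts 5, 7–9, GEN 4's `MultTowerCert.…_atTwo`, `MultTowerCert.…_{nonsplit,split}Two`) use
`E(ℚ)[2] = 0` TWICE: for the exact count `#X/(2,T^{2ⁿ})X = #A_n[2]` (upper layer) and for `#Sel_n[2] ≤ #X/(2,T^{2ⁿ})X` (lower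
layer). ord-2 GEN 4 (`…TowerLayerTorsion.lean`) removed it in the EXACT `A`-count currency, paying `#ker h_j = #E[2^∞]^{Gal(ℚ̄/ℚ_j)}`
on the lower side (`TowerClass.towerGapAtTwo_of_counts_of_torsion`). Here the same is done in the LOCAL-KERNEL currency the
multiplicative class files use:

* §0 `finite_selmerLayer_pTorsion_of_finite_ker` (any number field, any `p`, any `ℤ_p`-extension): `Sel_{p^∞}(E/K_n)[p]` is
  finite as soon as `ker h_n` and `T_n = Sel_∞[p]^{γ^{pⁿ}}` are (the map `h_n : Sel_n[p] → T_n` of tower-1 / ord-2 has finite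
  kernel and finite range) — the finiteness premise of tower-1's evaluation map `natCard_layerClasses_le_of_localKernelBounds`,
  which is itself torsion-free.
* §1 `towerGapAtTwo_of_localKernelBounds_of_torsion` — `O1.TowerGapAtTwo W` for ANY elliptic `W/ℚ` (no torsion hypothesis)
  from: the finiteness of `E(ℚ_∞)[2^∞]` (`hB`, per `W`; PRINT as `Greenberg1999.finite_torsion_cyclotomicZpExtension`), layers
  `j ≤ j'`, a LOWER count `2^a ≤ #Sel_{2^∞}(E/ℚ_j)[2]`, a TORSION count `#E[2^∞]^{Gal(ℚ̄/ℚ_j)} ≤ 2^t`, an UPPER count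
  `#Sel_{2^∞}(E/ℚ_{j'})[2] ≤ 2^d`, the level-`j'` local kernel hypotheses {`h0`, `hC`, `hN`} of tower-1 part 3b VERBATIM, and the
  arithmetic `2^{d+t} · ∏_{v∈S} C_v^{N_v} < 2^{2^{j'} − 2^j + a}`. Chain: `#X/(2,T^{2^{j'}})X = #T_{j'} ≤ #A_{j'}[2] ≤
  #Sel_{j'}[2] · ∏ C_v^{#R_v}` (ord-2's `natCard_fixedPTorsion_le_natCard_layerClasses_of_finite_ker`, tower-1's evaluation map)
  and `2^a ≤ #Sel_j[2] ≤ #ker h_j · #T_j ≤ 2^t · #X/(2,T^{2^j})X`. ONE extra bit per unit of `t` relative to the odd-torsion door;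
  with `t = 0` it is that door again.
* (also §1) the SHARP-cover form `…_sharp_of_torsion` (tower-1 part 5: `N_v = 1` at the place over `2`).
* PART 2 (`…MultUpperHalfTowerTorsionCert.lean`): the NUMERIC / rational-prime / decidable-CERT layers of GEN 4's
  `MultTowerCert.towerGapAtTwo_of_layerSelmer_{numeric,nat,cert}_atTwo` («constant at `2` a DATUM `C₂`»), re-derived VERBATIM on
  top of §1 (`htors` ↦ {`hB`, `htor`}, `2^d` ↦ `2^{d+t}`). PART 3 (`…MultUpperHalfTowerTorsionLocal.lean`): the constant at the
  multiplicative `2` from PRINT (non-split `4` / split `2^{k_q}`, GEN 4 `MultTowerLocal`), lower layer `ℚ` with the torsion count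
  a DECIDABLE point count at a good odd prime (ord-2 KitD `natCard_fixedPoints_geomPrimaryTorsion_le_pow_of_good`), `hB` from
  the PRINT named fact `Greenberg1999.finite_torsion_cyclotomicZpExtension`, and the UPPER HALF for the CLASS via GEN 3's class
  theorem `missingUpperBoundAt_two_mult_of_towerGapMember'` with the period datum DISPLAYED (optimality datum or `0 ≤ ord₂ ϖ`;
  `Irr` fails on these classes) — what a per-class file `…MultTowerClass<label>.lean` of a «neither» class applies.

WHAT IS DISPLAYED, NOT PROVED (this part): the finiteness `hB` (PRINT by name in part 3), the local kernel hypotheses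
{`h0`, `hC`, `hN`} (PRINT readings + certificates in parts 2–3); CERTIFICATES {`hlow`, `hup`, `htor`, arithmetic} (tower-eng
ENGINE A with mult-3's node patch on the optimal «neither» curves: this seat's kit j256117). ∀-LEVEL CONTENT: none (road (i) discharged per class; GEN 4's NEITHER-142-structure
note: on these classes the item at the class ⟺ `μ(X(E₀/ℚ_∞)) = 0`, which is what the gap certifies).

References: R. Greenberg, LNM 1716 (1999), §1 pp. 60–62, §3 pp. 85–94 (Lemmas 3.1–3.5, after Prop. 3.6), §4 Lemma 4.3,
pp. 112–113; L. Washington, *Introduction to Cyclotomic Fields*, §13.1–13.2; J. Silverman, AEC, VII.3.1(b), VII.5.1;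
K. Česnavičius (2018) Thm. 1.2; J. W. S. Cassels, Arithmetic VIII (1965); R. L. Miller, LMS JCM 14 (2011) Def. 1.1;
K. Ribet, appendix to Katz–Lang (1981).
-/

set_option autoImplicit false
-- the Theorems namespace of this sub repeats the summit name by design (D-0017 nested layout: Summit.<S>.<Sub>)
set_option linter.dupNamespace false

noncomputable section

open scoped Classical MatrixGroups ModularForm

open NumberField IsDedekindDomain CongruenceSubgroup WeierstrassCurve Literature.NumberTheory.EllipticCurves
  Literature.NumberTheory.EllipticCurves.ModularForms
  Literature.NumberTheory.EllipticCurves.Greenberg1999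
  Literature.NumberTheory.EllipticCurves.Rank1Residual
  Literature.NumberTheory.EllipticCurves.Rank1Residual.Typed
  Literature.NumberTheory.GaloisRepresentations
  Summit.BirchSwinnertonDyer.Rank1Residual.X5 Summit.BirchSwinnertonDyer.Rank1Residual.X5.O1
  Summit.BirchSwinnertonDyer.Rank1Residual.X5.TowerGap
  Summit.BirchSwinnertonDyer.Rank1Residual
  Summit.BirchSwinnertonDyer.BirchSwinnertonDyer.Theorems.KatoHalfPinch
  Rat.HeightOneSpectrum

universe u

namespace Summit.BirchSwinnertonDyer.BirchSwinnertonDyer.Theorems.MultTowerTorsion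

/-! ## §0 `Sel_{p^∞}(E/K_n)[p]` is finite when `ker h_n` and `T_n` are -/

section Layer

variable {K : Type u} [Field K] [NumberField K] (W : WeierstrassCurve K) {p : ℕ}
  [hp : Fact p.Prime] (κ : ZpExtension K p)

/-- **`Sel_{p^∞}(E/K_n)[p]` is finite** whenever `ker h_n` is finite and `T_n = Sel_∞[p]^{γ^{pⁿ}}` is finite: `h_n` carries
`Sel_n[p]` into `T_n` (`selmerLayer_le_selmerInftyPreimage`, `range_layerToInfty_le_layerInvariants_holds`) with kernel
inside `ker h_n`, and an additive group with finite kernel and finite range of one hom is finite. (The counting twin is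
ord-2's `TowerLayer.natCard_selmerLayer_pTorsion_le_mul`.) [cite: GreenbergLNM1716, §1 Thm. 1.2 and §3 pp. 85–86] -/
theorem finite_selmerLayer_pTorsion_of_finite_ker (γ : Field.absoluteGaloisGroup K) (n : ℕ)
    (hfin : Finite (W.layerToInfty κ n).ker)
    (hT : Finite {s : W.selmerInfty κ // p • s = 0 ∧
      W.conjH1 p κ.kerSubgroup (γ ^ p ^ n) (s : W.subgroupH1 p κ.kerSubgroup) = s}) :
    Finite {z : W.selmerLayer κ n // p • z = 0} := by
  set L := W.subgroupH1 p (κ.layerSubgroup n) with hL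
  set h := W.layerToInfty κ n with hh
  let S : AddSubgroup L := W.selmerLayer κ n ⊓ (DistribSMul.toAddMonoidHom L p).ker
  have hS : ∀ y : L, y ∈ S ↔ y ∈ W.selmerLayer κ n ∧ p • y = 0 := fun y ↦ by
    simp only [S, AddSubgroup.mem_inf, AddMonoidHom.mem_ker, DistribSMul.toAddMonoidHom_apply]
  let ψ : S →+ W.subgroupH1 p κ.kerSubgroup := h.comp S.subtype
  -- finite kernel (inside `ker h`)
  have hψker : Finite ψ.ker := by
    haveI := hfin
    refine Finite.of_injective (fun y : ψ.ker ↦ (⟨(y.1 : L), ?_⟩ : h.ker)) ?_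
    · have := (AddMonoidHom.mem_ker).mp y.2
      rw [AddMonoidHom.mem_ker]
      simpa [ψ] using this
    · intro y y' hyy'
      have := congrArg (fun w : h.ker ↦ (w : L)) hyy'
      exact Subtype.ext (Subtype.ext this)
  -- finite range (inside `T_n`)
  have hψrange : Finite ψ.range := by
    haveI := hT
    refine Finite.of_injective (fun x : ψ.range ↦ (⟨⟨x.1, ?_⟩, ?_, ?_⟩ : {s : W.selmerInfty κ //
      p • s = 0 ∧ W.conjH1 p κ.kerSubgroup (γ ^ p ^ n) (s : W.subgroupH1 p κ.kerSubgroup) = s})) ?_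
    · obtain ⟨y, hy⟩ := x.2
      rw [← hy]
      exact (mem_selmerInftyPreimage_iff W κ n _).mp
        (W.selmerLayer_le_selmerInftyPreimage κ n ((hS _).mp y.2).1)
    · obtain ⟨y, hy⟩ := x.2
      apply Subtype.ext
      rw [AddSubgroup.coe_nsmul, AddSubgroup.coe_mk, ← hy]
      change p • h (y : L) = 0
      rw [← map_nsmul, ((hS _).mp y.2).2, map_zero]
    · obtain ⟨y, hy⟩ := x.2
      rw [AddSubgroup.coe_mk, ← hy]
      exact TowerLayer.conjH1_pow_layerToInfty W κ γ n (y : L)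
    · intro x x' hxx'
      have := congrArg (fun s : {s : W.selmerInfty κ // p • s = 0 ∧
        W.conjH1 p κ.kerSubgroup (γ ^ p ^ n) (s : W.subgroupH1 p κ.kerSubgroup) = s} ↦
          ((s.1 : W.selmerInfty κ) : W.subgroupH1 p κ.kerSubgroup)) hxx'
      exact Subtype.ext this
  haveI : Finite S := (AddMonoidHom.finite_iff_finite_ker_range ψ).mpr ⟨hψker, hψrange⟩
  -- transfer to the subtype
  refine Finite.of_injective (fun z : {z : W.selmerLayer κ n // p • z = 0} ↦
    (⟨(z.1 : L), (hS _).mpr ⟨z.1.2, by rw [← AddSubgroup.coe_nsmul, z.2, AddSubgroup.coe_zero]⟩⟩ : S)) ?_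
  intro z z' hzz'
  have := congrArg (fun w : S ↦ (w : L)) hzz'
  exact Subtype.ext (Subtype.ext this)

end Layer

/-! ## §1 The torsion-tolerant GAP door in local-kernel currency -/

section Gap

variable (W : WeierstrassCurve ℚ) [W.IsElliptic]

/-- **The GAP certificate from two layers with explicit local error terms, RATIONAL `2`-TORSION ALLOWED.** For an
elliptic `W/ℚ` (no torsion hypothesis), granted the finiteness of `E(ℚ_∞)[2^∞]` for every cyclotomic `ℤ₂`-extension
datum (`hB`): layers `j ≤ j'`; a LOWER count `2^a ≤ #Sel_{2^∞}(E/ℚ_j)[2]`; a TORSION count `#E[2^∞]^{Gal(ℚ̄/ℚ_j)} ≤ 2^t`;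
an UPPER count `#Sel_{2^∞}(E/ℚ_{j'})[2] ≤ 2^d`; at level `j'` the local kernel hypotheses of tower-1 part 3b — `𝒦_{v,j'}[2^∞] = 0`
off `S` (`h0`), `#𝒦_{v,j'}[2] ≤ C_v` on `S` (`hC`), covering sets of size `≤ N_v` (`hN`) —; and the arithmetic
`2^{d+t} · ∏_{v∈S} C_v^{N_v} < 2^{2^{j'} − 2^j + a}`. Then `O1.TowerGapAtTwo W`:
`2^t · #X/(2,T^{2^{j'}})X = 2^t · #T_{j'} ≤ 2^t · #A_{j'}[2] ≤ 2^t · #Sel_{j'}[2] · ∏ C_v^{#R_v} ≤ 2^{d+t} · ∏ C_v^{N_v} <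
2^{2^{j'}−2^j} · 2^a ≤ 2^{2^{j'}−2^j} · #ker h_j · #T_j ≤ 2^t · (2^{2^{j'}−2^j} · #X/(2,T^{2^j})X)`.
[cite: GreenbergLNM1716, §1 p. 60, §3 pp. 85–90 (Lemmas 3.1, 3.2, 3.5), §4 Lemma 4.3] [cite: Washington1997, §13.2] -/
theorem towerGapAtTwo_of_localKernelBounds_of_torsion
    (hB : ∀ κ : ZpExtension ℚ 2, κ.IsCyclotomic →
      Finite (FixedPoints.addSubgroup κ.kerSubgroup (geomPrimaryTorsion W 2)))
    {j j' a d t : ℕ} (hjj' : j ≤ j') (S : Finset (HeightOneSpectrum (𝓞 ℚ))) (C N : HeightOneSpectrum (𝓞 ℚ) → ℕ)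
    (hlow : ∀ κ : ZpExtension ℚ 2, κ.IsCyclotomic →
      2 ^ a ≤ Nat.card {z : W.selmerLayer κ j // 2 • z = 0})
    (htor : ∀ κ : ZpExtension ℚ 2, κ.IsCyclotomic →
      Nat.card {m : geomPrimaryTorsion W 2 | ∀ σ ∈ κ.layerSubgroup j, σ • m = m} ≤ 2 ^ t)
    (hup : ∀ κ : ZpExtension ℚ 2, κ.IsCyclotomic →
      Nat.card {z : W.selmerLayer κ j' // 2 • z = 0} ≤ 2 ^ d)
    (h0 : ∀ κ : ZpExtension ℚ 2, κ.IsCyclotomic →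
      ∀ v ∉ S, W.localTowerKerPrimary κ (v.adicCompletion ℚ) j' = ⊥)
    (hC : ∀ κ : ZpExtension ℚ 2, κ.IsCyclotomic → ∀ v ∈ S,
      Finite {x : W.localTowerKerPrimary κ (v.adicCompletion ℚ) j' // 2 • x = 0} ∧
        Nat.card {x : W.localTowerKerPrimary κ (v.adicCompletion ℚ) j' // 2 • x = 0} ≤ C v)
    (hN : ∀ κ : ZpExtension ℚ 2, κ.IsCyclotomic → ∀ v ∈ S,
      ∃ R : Finset (Field.absoluteGaloisGroup ℚ), R.card ≤ N v ∧
        ∀ σ : Field.absoluteGaloisGroup ℚ, ∃ ρ ∈ R,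
          ∃ δ : Field.absoluteGaloisGroup (v.adicCompletion ℚ), ∃ τ ∈ κ.layerSubgroup j',
            σ = resGal (K := ℚ) (v.adicCompletion ℚ) δ * ρ * τ)
    (harith : 2 ^ (d + t) * ∏ v ∈ S, C v ^ N v < 2 ^ (2 ^ j' - 2 ^ j + a)) : TowerGapAtTwo W := by
  intro κ γ hκ hγ _ D
  haveI : Module.Finite (IwasawaAlgebra 2) D.X := D.module_finite_holds hγ
  haveI := hB κ hκ
  have hfinj : Finite (W.layerToInfty κ j).ker := TowerLayer.finite_ker_layerToInfty W κ j
  have hfinj' : Finite (W.layerToInfty κ j').ker := TowerLayer.finite_ker_layerToInfty W κ j'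
  have hTj : Finite {s : W.selmerInfty κ // 2 • s = 0 ∧
      W.conjH1 2 κ.kerSubgroup (γ ^ 2 ^ j) (s : W.subgroupH1 2 κ.kerSubgroup) = s} :=
    TowerLayer.finite_fixedPTorsion D j
  have hTj' : Finite {s : W.selmerInfty κ // 2 • s = 0 ∧
      W.conjH1 2 κ.kerSubgroup (γ ^ 2 ^ j') (s : W.subgroupH1 2 κ.kerSubgroup) = s} :=
    TowerLayer.finite_fixedPTorsion D j'
  have hSel : Finite {z : W.selmerLayer κ j' // 2 • z = 0} :=
    finite_selmerLayer_pTorsion_of_finite_ker W κ γ j' hfinj' hTj'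
  have hpow : 2 ^ j ≤ 2 ^ j' := Nat.pow_le_pow_right (by norm_num) hjj'
  choose! R hRcard hRcov using hN κ hκ
  -- `1 ≤ C v` on `S` (the `2`-torsion of `𝒦_{v,j'}` contains `0`)
  have hCpos : ∀ v ∈ S, 1 ≤ C v := fun v hv ↦ by
    haveI := (hC κ hκ v hv).1
    haveI : Nonempty {x : W.localTowerKerPrimary κ (v.adicCompletion ℚ) j' // 2 • x = 0} :=
      ⟨⟨0, smul_zero _⟩⟩
    exact Nat.succ_le_of_lt (lt_of_lt_of_le Nat.card_pos (hC κ hκ v hv).2)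
  refine ⟨2 ^ j, 2 ^ j' - 2 ^ j, ?_⟩
  rw [Nat.add_sub_cancel' hpow]
  have ej' : Nat.card (D.X ⧸ (towerIdeal 2 (2 ^ j') • ⊤ : Submodule (IwasawaAlgebra 2) D.X)) =
      Nat.card {s : W.selmerInfty κ // 2 • s = 0 ∧
        W.conjH1 2 κ.kerSubgroup (γ ^ 2 ^ j') (s : W.subgroupH1 2 κ.kerSubgroup) = s} := by
    rw [← KatoHalfPinch.layerIdeal_eq_towerIdeal, TowerLayer.natCard_quotient_layerIdeal_eq D j']
  have ej : Nat.card (D.X ⧸ (towerIdeal 2 (2 ^ j) • ⊤ : Submodule (IwasawaAlgebra 2) D.X)) =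
      Nat.card {s : W.selmerInfty κ // 2 • s = 0 ∧
        W.conjH1 2 κ.kerSubgroup (γ ^ 2 ^ j) (s : W.subgroupH1 2 κ.kerSubgroup) = s} := by
    rw [← KatoHalfPinch.layerIdeal_eq_towerIdeal, TowerLayer.natCard_quotient_layerIdeal_eq D j]
  rw [ej', ej]
  -- the upper chain
  have hU : Nat.card {s : W.selmerInfty κ // 2 • s = 0 ∧
      W.conjH1 2 κ.kerSubgroup (γ ^ 2 ^ j') (s : W.subgroupH1 2 κ.kerSubgroup) = s} ≤
        2 ^ d * ∏ v ∈ S, C v ^ N v :=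
    calc Nat.card {s : W.selmerInfty κ // 2 • s = 0 ∧
          W.conjH1 2 κ.kerSubgroup (γ ^ 2 ^ j') (s : W.subgroupH1 2 κ.kerSubgroup) = s}
        ≤ Nat.card {z : W.selmerInftyPreimage κ j' // 2 • z = 0} :=
          TowerLayer.natCard_fixedPTorsion_le_natCard_layerClasses_of_finite_ker W κ hγ j' hfinj'
      _ ≤ Nat.card {z : W.selmerLayer κ j' // 2 • z = 0} * ∏ v ∈ S, C v ^ (R v).card :=
          TowerLayer.natCard_layerClasses_le_of_localKernelBounds W κ S C R (h0 κ hκ) (hC κ hκ) hRcov hSel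
      _ ≤ 2 ^ d * ∏ v ∈ S, C v ^ N v :=
          Nat.mul_le_mul (hup κ hκ) (Finset.prod_le_prod (fun v _ ↦ Nat.zero_le _)
            fun v hv ↦ Nat.pow_le_pow_right (hCpos v hv) (hRcard v hv))
  -- the lower chain
  have hK : Nat.card (W.layerToInfty κ j).ker ≤ 2 ^ t := by
    rw [W.natCard_ker_layerToInfty_eq_natCard_fixedPoints κ j]; exact htor κ hκ
  have hL : 2 ^ a ≤ 2 ^ t * Nat.card {s : W.selmerInfty κ // 2 • s = 0 ∧
      W.conjH1 2 κ.kerSubgroup (γ ^ 2 ^ j) (s : W.subgroupH1 2 κ.kerSubgroup) = s} :=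
    (hlow κ hκ).trans ((TowerLayer.natCard_selmerLayer_pTorsion_le_mul W κ γ j hfinj hTj).trans
      (Nat.mul_le_mul_right _ hK))
  -- combine
  have key : 2 ^ t * Nat.card {s : W.selmerInfty κ // 2 • s = 0 ∧
      W.conjH1 2 κ.kerSubgroup (γ ^ 2 ^ j') (s : W.subgroupH1 2 κ.kerSubgroup) = s} <
        2 ^ t * (2 ^ (2 ^ j' - 2 ^ j) * Nat.card {s : W.selmerInfty κ // 2 • s = 0 ∧
          W.conjH1 2 κ.kerSubgroup (γ ^ 2 ^ j) (s : W.subgroupH1 2 κ.kerSubgroup) = s}) :=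
    calc 2 ^ t * Nat.card {s : W.selmerInfty κ // 2 • s = 0 ∧
          W.conjH1 2 κ.kerSubgroup (γ ^ 2 ^ j') (s : W.subgroupH1 2 κ.kerSubgroup) = s}
        ≤ 2 ^ t * (2 ^ d * ∏ v ∈ S, C v ^ N v) := Nat.mul_le_mul_left _ hU
      _ = 2 ^ (d + t) * ∏ v ∈ S, C v ^ N v := by rw [pow_add]; ring
      _ < 2 ^ (2 ^ j' - 2 ^ j + a) := harith
      _ = 2 ^ (2 ^ j' - 2 ^ j) * 2 ^ a := pow_add _ _ _
      _ ≤ 2 ^ (2 ^ j' - 2 ^ j) * (2 ^ t * Nat.card {s : W.selmerInfty κ // 2 • s = 0 ∧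
          W.conjH1 2 κ.kerSubgroup (γ ^ 2 ^ j) (s : W.subgroupH1 2 κ.kerSubgroup) = s}) :=
        Nat.mul_le_mul_left _ hL
      _ = 2 ^ t * (2 ^ (2 ^ j' - 2 ^ j) * Nat.card {s : W.selmerInfty κ // 2 • s = 0 ∧
          W.conjH1 2 κ.kerSubgroup (γ ^ 2 ^ j) (s : W.subgroupH1 2 κ.kerSubgroup) = s}) := by ring
  exact Nat.lt_of_mul_lt_mul_left key

/-- **The same with SHARP covers** (tower-1 part 5: `N_v = 1` at the place over `2` — `2` is totally ramified in `ℚ_∞`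
—, `N_v = 2^{min(j', v₂(ℓ_v² − 1) − 3)}` at an odd place). [cite: GreenbergLNM1716, §3 pp. 85–90 (Lemmas 3.3–3.5)]
[cite: Washington1997, §13.1] -/
theorem towerGapAtTwo_of_localKernelBounds_sharp_of_torsion
    (hB : ∀ κ : ZpExtension ℚ 2, κ.IsCyclotomic →
      Finite (FixedPoints.addSubgroup κ.kerSubgroup (geomPrimaryTorsion W 2)))
    {j j' a d t : ℕ} (hjj' : j ≤ j') (S : Finset (HeightOneSpectrum (𝓞 ℚ))) (C : HeightOneSpectrum (𝓞 ℚ) → ℕ)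
    (hlow : ∀ κ : ZpExtension ℚ 2, κ.IsCyclotomic →
      2 ^ a ≤ Nat.card {z : W.selmerLayer κ j // 2 • z = 0})
    (htor : ∀ κ : ZpExtension ℚ 2, κ.IsCyclotomic →
      Nat.card {m : geomPrimaryTorsion W 2 | ∀ σ ∈ κ.layerSubgroup j, σ • m = m} ≤ 2 ^ t)
    (hup : ∀ κ : ZpExtension ℚ 2, κ.IsCyclotomic →
      Nat.card {z : W.selmerLayer κ j' // 2 • z = 0} ≤ 2 ^ d)
    (h0 : ∀ κ : ZpExtension ℚ 2, κ.IsCyclotomic →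
      ∀ v ∉ S, W.localTowerKerPrimary κ (v.adicCompletion ℚ) j' = ⊥)
    (hC : ∀ κ : ZpExtension ℚ 2, κ.IsCyclotomic → ∀ v ∈ S,
      Finite {x : W.localTowerKerPrimary κ (v.adicCompletion ℚ) j' // 2 • x = 0} ∧
        Nat.card {x : W.localTowerKerPrimary κ (v.adicCompletion ℚ) j' // 2 • x = 0} ≤ C v)
    (harith : 2 ^ (d + t) * ∏ v ∈ S, C v ^
        (if ((2 : ℕ) : 𝓞 ℚ) ∈ v.asIdeal then 1
          else 2 ^ min j' (padicValNat 2 (natGenerator v ^ 2 - 1) - 3)) <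
      2 ^ (2 ^ j' - 2 ^ j + a)) : TowerGapAtTwo W := by
  refine towerGapAtTwo_of_localKernelBounds_of_torsion W hB hjj' S C
    (fun v ↦ if ((2 : ℕ) : 𝓞 ℚ) ∈ v.asIdeal then 1
      else 2 ^ min j' (padicValNat 2 (natGenerator v ^ 2 - 1) - 3))
    hlow htor hup h0 hC (fun κ hκ v _ ↦ ?_) harith
  by_cases h2 : ((2 : ℕ) : 𝓞 ℚ) ∈ v.asIdeal
  · refine ⟨{1}, by rw [if_pos h2, Finset.card_singleton], ?_⟩
    exact TowerLayer.cover_singleton_at_p κ hκ v h2 j'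
  · rw [if_neg h2]
    exact TowerLayer.exists_cover_card_le_odd_two hκ v h2 j'

end Gap

end Summit.BirchSwinnertonDyer.BirchSwinnertonDyer.Theorems.MultTowerTorsion

end
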